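/-
Copyright (c) 2026 the pub-hodgecm-mathlib formalisation cell (harness21).  Prover seat hodgecm-mathlib-K2E1-p12 (g2), Track B ∕ K2-LIT, h413 =
`stmt-HodgeConjecture-24833`, line `K2_E1_TraceFormulaBeta`, (225) FILE β1 of the dealer K2E1-plan (g7) — the `N = 2` twin (`U(1,1)∕CM`, `D⁺ = {½ < re ∧ 0 < im}`, tube `1 < re`,
shift `z + z̄′ − 1`) of ★ p859921 `K2E1MaassSelbergDiagonalFourTermCMThree` (K2E1-p11 (g2)): THE DIAGONAL MAASS–SELBERG IDENTITY `‖F z‖² = R(z, z; c̃)` on the per-ball holomorphy domain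
`D₁` and the OFF-AXIS `L²` BOUND of the truncated spherical Eisenstein family of `U(1,1)∕CM`.
-/
import Summits.HodgeConjecture.HodgeConjecture.Theorems.K2E1MaassSelbergContinuedOnBoxesCMTwo     -- ★ (K2E4-p11): the general-box `_on'` editions at `N = 2`; brings ★ `K2E1MaassSelbergContinuedOnCMTwo` (`differentiableOn_fourTerm_fst_on∕_snd_conj_on`), ★ PairingContinuedCMTwo (`exists_fourTerm_tube_cm_two`), ★ CMTwo §0∕§1
import Summits.HodgeConjecture.HodgeConjecture.Theorems.K2E1MaassSelbergSphericalBracketsCMThree  -- ★ `idelicBracket_pos` (generic CM field)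
import HarnessLib

/-!
# h413 ∕ Track B «K2-LIT», (MS-real)₂ — `K2E1MaassSelbergDiagonalFourTermCMTwo`: the diagonal four-term identity `‖F z‖² = R(z, z; c̃)` on `D₁` and the local `L²`-bound of the truncated
# Eisenstein family of `U(1,1)∕CM` near non-real points where the scalar `c̃` is bounded — the `N = 2` twin of ★ p859921

Cell `pub/hodgecm-mathlib`, crux H413 = `stmt-HodgeConjecture-24833`, route `HCCMUnconditional`; prover seat `hodgecm-mathlib-K2E1-p12` (g2), deal (225) of the dealer K2E1-plan (g7)
(the (MS-real)₂ chain: FILE α ★ p860161 → β1 (this file) → β2 `…DiagonalLowerCMTwo` → β3 `K2E1SphericalEisensteinL2BoundCMTwo` → γ `…L2ResidueCMTwo`).  THEOREMS ONLY (no `def` ∕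
`instance` ∕ `notation` ∕ named-fact hypothesis ∕ `sorry`; default heartbeats); lane `--kind proof --supports stmt-HodgeConjecture-24833 --as helper` (count-neutral; closes no socket).
The byte-for-byte `N = 2` twin of ★ `K2E1MaassSelbergDiagonalFourTermCMThree` with `3 ↦ 2`, `D⁺ = {1 < re ∧ 0 < im} ↦ {½ < re ∧ 0 < im}`, tube `2 < re ↦ 1 < re`, shift `− 2 ↦ − 1`, every
input replaced by its ★ `N = 2` twin (`exists_fourTerm_tube_cm_two`, `K2E1MaassSelbergContinuedOnCMTwo.differentiableOn_fourTerm_*`, `add_sub_one_ne_zero_and_sub_ne_zero`,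
`K2E1MaassSelbergSphericalBracketsCMTwo.measureReal_maximalCompact_pos`).
THE MATHEMATICS [MoeglinWaldspurger1995, IV.2.3, IV.3.12 (a); Arthur1980TraceFormulaII, §4].  The continued Maass–Selberg relation identifies the pairing `⟪Λ^TẼ(z′), Λ^TẼ(z)⟫` with the
four-term `R(z, z′; c̃)` on the sub-tube, hence (identity theorem in `(z, w = conj z′)` on `D₁ × conj⁻¹D₁`, ★ `eqOn_prod_of_separately_differentiableOn`) everywhere on `D₁ × D₁`; on the
DIAGONAL this reads `‖Λ^TẼ(z)‖² = R(z, z; c̃(z))` (§1 — the step the ★ `_on'` editions keep internal).  The right side is a continuous function of `(z, c̃(z))` as long as `Re z > ½` and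
`Im z ≠ 0` (denominators `2Re z − 1`, `2i·Im z`), so wherever `c̃` stays bounded near a NON-REAL `z₀ ∈ D⁺` the family stays `L²`-bounded there (§2, continuity on `D⁺ × ℂ` + compactness of
`closedBall z₀ r × closedBall 0 C₁`).  No bound is asserted near REAL points (`Im z → 0`) — those are FILE α ★ p860161 + β2∕β3.
* §1 `diag_eq_fourTerm_of_pairing_on'` (pairing level), **`normSq_family_eq_fourTerm_on'`** (family level: `∃ cμ K > 0, ∀ z ∈ D₁, (‖F z‖² : ℂ) = R(z, z; c̃)`).
* §2 **`norm_family_le_of_scalar_bound_on'`** — `‖c̃ z‖ ≤ C₁` for `z ∈ D₁` near a non-real `z₀ ∈ D⁺` ⟹ `∃ C, ‖F z‖ ≤ C` for `z ∈ D₁` near `z₀`.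
HONEST LABEL.  Count-neutral helper; proves no printed statement; conditional on the `_on'` binders (`F`, `c̃`, boxes); HC_CM is proved only modulo the 7 printed citations (2 remaining named
inputs: hLiu418 = `stmt-HodgeConjecture-24832`, h413 = `stmt-HodgeConjecture-24833`) until rung 0 closes.

## References
* [MoeglinWaldspurger1995] C. Mœglin, J.-L. Waldspurger, *Spectral decomposition and Eisenstein series* (1995), IV.2.3, IV.3.12 (a).
* [Arthur1980TraceFormulaII] J. Arthur, *A trace formula for reductive groups II*, Compositio Math. 40 (1980), §4.
* [BernsteinLapid2019] J. Bernstein, E. Lapid, *On the meromorphic continuation of Eisenstein series*, J. AMS 37 (2024), §4.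
-/

set_option autoImplicit false
-- the mandated namespace repeats `HodgeConjecture.HodgeConjecture`, as in every `Theorems/*.lean` of this sub-problem
set_option linter.dupNamespace false

noncomputable section

open MeasureTheory MeasureTheory.Measure Set NumberField IsDedekindDomain Filter Topology Metric
open scoped NNReal ENNReal ComplexConjugate InnerProductSpace
open Literature.MeasureTheory.Group Literature.NumberTheory
open Literature.NumberTheory.Automorphic Literature.NumberTheory.Automorphic.UnitaryGroup AdelicGroupData
open Summit.HodgeConjecture.HodgeConjecture.Cruxes.H413.K2E1BorelEisensteinU
open Summit.HodgeConjecture.HodgeConjecture.Cruxes.H413.K2E1BLBorelSpacesU2Defs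
open Summit.HodgeConjecture.HodgeConjecture.Cruxes.H413.K2E1MaassSelbergContinuedCMTwo (differentiableOn_conj_comp_conj eqOn_prod_of_separately_differentiableOn add_sub_one_ne_zero_and_sub_ne_zero)
open Summit.HodgeConjecture.HodgeConjecture.Cruxes.H413.K2E1MaassSelbergPairingCMTwo (pairing_of_differentiableOn)
open Summit.HodgeConjecture.HodgeConjecture.Cruxes.H413.K2E1MaassSelbergPairingContinuedCMTwo (exists_fourTerm_tube_cm_two)
open Summit.HodgeConjecture.HodgeConjecture.Cruxes.H413.K2E1MaassSelbergSphericalBracketsCMTwo (measureReal_maximalCompact_pos)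
open Summit.HodgeConjecture.HodgeConjecture.Cruxes.H413.K2E1MaassSelbergSphericalBracketsCMThree (idelicBracket_pos)
open Summit.HodgeConjecture.HodgeConjecture.Cruxes.H413.K2E1MaassSelbergContinuedOnCMTwo (differentiableOn_fourTerm_fst_on differentiableOn_fourTerm_snd_conj_on)


namespace Summit.HodgeConjecture.HodgeConjecture.Cruxes.H413.K2E1MaassSelbergDiagonalFourTermCMTwo

/-! ## §1 The diagonal four-term identity on `D₁` -/

section Diagonal

/-- **THE DIAGONAL FOUR-TERM IDENTITY ON `D₁`** (the `hdiag` step of ★ `poleControl_continued_cm_two_of_pairing_on'`, exported): under the general-box `_on'` hypotheses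
(`D₁ ⊆ D⁺` open preconnected with two sub-tube boxes, `c̃` holomorphic on `D₁`, the pairing `Φ` holomorphic ∕ anti-holomorphic, `Φ = R(z, z′; c̃)` on the sub-tube), for EVERY `z ∈ D₁`:
`Φ z z = R(z, z; c̃)` — the two-variable identity theorem ★ `eqOn_prod_of_separately_differentiableOn` on `D₁ × conj⁻¹ D₁`, then the diagonal `w = conj z`.
[cite: MoeglinWaldspurger1995, IV.2.3, IV.3.12 (a)] [cite: Arthur1980TraceFormulaII, §4] -/
theorem diag_eq_fourTerm_of_pairing_on' {D₁ : Set ℂ} (hD₁ : IsOpen D₁) (hD₁c : IsPreconnected D₁) (hD₁sub : D₁ ⊆ {z : ℂ | 1 / 2 < z.re ∧ 0 < z.im})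
    {O₁ O₂' : Set ℂ} (hO₁ : IsOpen O₁) (hO₁ne : O₁.Nonempty) (hO₁D : O₁ ⊆ D₁) (hO₂' : IsOpen O₂') (hO₂'ne : O₂'.Nonempty) (hO₂'D : O₂' ⊆ D₁)
    (hsep : ∀ z ∈ O₁, ∀ z' ∈ O₂', 1 < z'.re ∧ z'.re < z.re)
    {T cμ K κ m : ℝ} (hT : 1 ≤ T) {φ₀ : ℂ}
    {c : ℂ → ℂ} (hc : DifferentiableOn ℂ c D₁)
    {Φ : ℂ → ℂ → ℂ}
    (hΦ₁ : ∀ z' ∈ D₁, DifferentiableOn ℂ (fun z : ℂ => Φ z z') D₁)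
    (hΦ₂ : ∀ z ∈ D₁, DifferentiableOn ℂ (fun w : ℂ => Φ z (conj w)) {w : ℂ | conj w ∈ D₁})
    (hrel : ∀ z ∈ D₁, ∀ z' ∈ D₁, 1 < z'.re → z'.re < z.re →
      Φ z z' = ((cμ : ℝ) : ℂ) * (((K : ℝ) : ℂ) *
        ((((T : ℝ) : ℂ) ^ (z + conj z' - 1) / (z + conj z' - 1)) * (((κ : ℝ) : ℂ) * (((m : ℝ) : ℂ) * (φ₀ * conj φ₀)))
          + (((T : ℝ) : ℂ) ^ (z - conj z') / (z - conj z')) * (((κ : ℝ) : ℂ) * (((m : ℝ) : ℂ) * (φ₀ * conj (c z' * φ₀))))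
          - (((T : ℝ) : ℂ) ^ (-(z - conj z')) / (z - conj z')) * (((κ : ℝ) : ℂ) * (((m : ℝ) : ℂ) * (c z * φ₀ * conj φ₀)))
          - (((T : ℝ) : ℂ) ^ (-(z + conj z' - 1)) / (z + conj z' - 1)) * (((κ : ℝ) : ℂ) * (((m : ℝ) : ℂ) * (c z * φ₀ * conj (c z' * φ₀)))))))
    {z : ℂ} (hzD : z ∈ D₁) :
    Φ z z = ((cμ : ℝ) : ℂ) * (((K : ℝ) : ℂ) *
        ((((T : ℝ) : ℂ) ^ (z + conj z - 1) / (z + conj z - 1)) * (((κ : ℝ) : ℂ) * (((m : ℝ) : ℂ) * (φ₀ * conj φ₀)))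
          + (((T : ℝ) : ℂ) ^ (z - conj z) / (z - conj z)) * (((κ : ℝ) : ℂ) * (((m : ℝ) : ℂ) * (φ₀ * conj (c z * φ₀))))
          - (((T : ℝ) : ℂ) ^ (-(z - conj z)) / (z - conj z)) * (((κ : ℝ) : ℂ) * (((m : ℝ) : ℂ) * (c z * φ₀ * conj φ₀)))
          - (((T : ℝ) : ℂ) ^ (-(z + conj z - 1)) / (z + conj z - 1)) * (((κ : ℝ) : ℂ) * (((m : ℝ) : ℂ) * (c z * φ₀ * conj (c z * φ₀)))))) := by
  have hT0 : 0 < T := lt_of_lt_of_le one_pos hT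
  -- (1) the identity on `D⁺ × D⁻` in the variables `(z, w = conj z′)`
  set F : ℂ → ℂ → ℂ := fun z w => Φ z (conj w) with hF_def
  set G : ℂ → ℂ → ℂ := fun z w =>
      ((cμ : ℝ) : ℂ) * (((K : ℝ) : ℂ) *
        ((((T : ℝ) : ℂ) ^ (z + w - 1) / (z + w - 1)) * (((κ : ℝ) : ℂ) * (((m : ℝ) : ℂ) * (φ₀ * conj φ₀)))
          + (((T : ℝ) : ℂ) ^ (z - w) / (z - w)) * (((κ : ℝ) : ℂ) * (((m : ℝ) : ℂ) * (φ₀ * conj (c (conj w) * φ₀))))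
          - (((T : ℝ) : ℂ) ^ (-(z - w)) / (z - w)) * (((κ : ℝ) : ℂ) * (((m : ℝ) : ℂ) * (c z * φ₀ * conj φ₀)))
          - (((T : ℝ) : ℂ) ^ (-(z + w - 1)) / (z + w - 1)) * (((κ : ℝ) : ℂ) * (((m : ℝ) : ℂ) * (c z * φ₀ * conj (c (conj w) * φ₀)))))) with hG_def
  have hz : z ∈ {z : ℂ | 1 / 2 < z.re ∧ 0 < z.im} := hD₁sub hzD
  -- `D₂ := conj⁻¹ D₁` is open and preconnected
  have hD₂ : IsOpen {w : ℂ | conj w ∈ D₁} := hD₁.preimage Complex.continuous_conj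
  have hD₂c : IsPreconnected {w : ℂ | conj w ∈ D₁} := by
    have h1 : {w : ℂ | conj w ∈ D₁} = (fun z : ℂ => conj z) '' D₁ := by
      ext w
      refine ⟨fun hw => ⟨conj w, hw, Complex.conj_conj w⟩, ?_⟩
      rintro ⟨z, hz1, rfl⟩
      show conj (conj z) ∈ D₁
      rw [Complex.conj_conj]; exact hz1
    rw [h1]
    exact hD₁c.image _ Complex.continuous_conj.continuousOn
  have hconjD : ∀ w ∈ {w : ℂ | conj w ∈ D₁}, conj w ∈ D₁ := fun w hw => hw
  have hF₁ : ∀ w ∈ {w : ℂ | conj w ∈ D₁}, DifferentiableOn ℂ (fun z => F z w) D₁ := fun w hw => hΦ₁ (conj w) (hconjD w hw)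
  have hG₁ : ∀ w ∈ {w : ℂ | conj w ∈ D₁}, DifferentiableOn ℂ (fun z => G z w) D₁ := fun w hw => by
    have h := differentiableOn_fourTerm_fst_on hD₁sub (cμ := cμ) (K := K) (κ := κ) (m := m) hT0 φ₀ hc (hD₁sub (hconjD w hw))
    simp only [Complex.conj_conj] at h
    exact h
  have hF₂ : ∀ z ∈ D₁, DifferentiableOn ℂ (fun w => F z w) {w : ℂ | conj w ∈ D₁} := fun z hz => hΦ₂ z hz
  have hG₂ : ∀ z ∈ D₁, DifferentiableOn ℂ (fun w => G z w) {w : ℂ | conj w ∈ D₁} := fun z hz =>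
    differentiableOn_fourTerm_snd_conj_on hD₁ hD₁sub (cμ := cμ) (K := K) (κ := κ) (m := m) hT0 φ₀ hc (hD₁sub hz)
  -- the boxes: `O₁ ⊆ D₁`, `O₂ := conj⁻¹ O₂' ⊆ D₂`
  have hO₂ : IsOpen {w : ℂ | conj w ∈ O₂'} := hO₂'.preimage Complex.continuous_conj
  have hO₂ne : ({w : ℂ | conj w ∈ O₂'} : Set ℂ).Nonempty := by
    obtain ⟨z', hz'⟩ := hO₂'ne
    exact ⟨conj z', show conj (conj z') ∈ O₂' by rw [Complex.conj_conj]; exact hz'⟩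
  have hO₂D : {w : ℂ | conj w ∈ O₂'} ⊆ {w : ℂ | conj w ∈ D₁} := fun w hw => hO₂'D hw
  have heq : ∀ z ∈ O₁, ∀ w ∈ {w : ℂ | conj w ∈ O₂'}, F z w = G z w := by
    intro z hz w hw
    obtain ⟨h1, h2⟩ := hsep z hz (conj w) hw
    have h := hrel z (hO₁D hz) (conj w) (hO₂'D hw) h1 h2
    simp only [Complex.conj_conj] at h
    exact h
  have hid := eqOn_prod_of_separately_differentiableOn hD₁ hD₁c hD₂ hD₂c hO₁ hO₁ne hO₁D hO₂ hO₂ne hO₂D hF₁ hG₁ hF₂ hG₂ heq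
  -- (2) the diagonal `w = conj z`
  have hzc : conj z ∈ {w : ℂ | conj w ∈ D₁} := by
    show conj (conj z) ∈ D₁
    rw [Complex.conj_conj]; exact hzD
  have hdiag := hid z hzD (conj z) hzc
  simp only [hF_def, hG_def, Complex.conj_conj] at hdiag
  exact hdiag


end Diagonal

section Family

variable (L : Type) [Field L] [NumberField L] [IsCMField L]
variable [MeasurableSpace (quasiSplit (↥(maximalRealSubfield L)) L (IsCMField.complexConj L) 2).Adelic] [BorelSpace (quasiSplit (↥(maximalRealSubfield L)) L (IsCMField.complexConj L) 2).Adelic]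
variable [MeasurableSpace (AdeleRing (𝓞 L) L)ˣ] [BorelSpace (AdeleRing (𝓞 L) L)ˣ]

/-- **`‖F z‖² = R(z, z; c̃)` ON `D₁` FOR AN `L²`-HOLOMORPHIC FAMILY** (the family form of the diagonal identity; constants `cμ, K > 0` of ★ `exists_fourTerm_tube_cm_two`, brackets
`κ_ℝ = ∫_{|x|≤1}∩𝓕I |x| ∂νI`, `m_K = μK(K_U)`): under the hypotheses of ★ `poleControl_continued_cm_two_of_family_on'`,
`∃ cμ K > 0, ∀ z ∈ D₁, (‖F z‖² : ℂ) = R(z, z; c̃)`. [cite: MoeglinWaldspurger1995, IV.2.3, IV.3.12 (a)] [cite: BernsteinLapid2019, §4] -/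
theorem normSq_family_eq_fourTerm_on' {D₁ : Set ℂ} (hD₁ : IsOpen D₁) (hD₁c : IsPreconnected D₁) (hD₁sub : D₁ ⊆ {z : ℂ | 1 / 2 < z.re ∧ 0 < z.im})
    {O₁ O₂' : Set ℂ} (hO₁ : IsOpen O₁) (hO₁ne : O₁.Nonempty) (hO₁D : O₁ ⊆ D₁) (hO₂' : IsOpen O₂') (hO₂'ne : O₂'.Nonempty) (hO₂'D : O₂' ⊆ D₁)
    (hsep : ∀ z ∈ O₁, ∀ z' ∈ O₂', 1 < z'.re ∧ z'.re < z.re)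
    (μ : Measure (quasiSplit (↥(maximalRealSubfield L)) L (IsCMField.complexConj L) 2).automorphicQuotient) [(quasiSplit (↥(maximalRealSubfield L)) L (IsCMField.complexConj L) 2).IsAutomorphicMeasure μ]
    (νG : Measure (quasiSplit (↥(maximalRealSubfield L)) L (IsCMField.complexConj L) 2).Adelic) [νG.IsHaarMeasure] [νG.IsInvInvariant]
    (μK : Measure ((standardMaximalCompactGL 2 L).comap (adelicVal (↥(maximalRealSubfield L)) L (IsCMField.complexConj L) 2 ((StdForm.antidiagonal 2).over L)) : Subgroup (quasiSplit (↥(maximalRealSubfield L)) L (IsCMField.complexConj L) 2).Adelic))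
    [μK.IsHaarMeasure]
    (νI : Measure (AdeleRing (𝓞 L) L)ˣ) [νI.IsHaarMeasure]
    {𝓕I : Set (AdeleRing (𝓞 L) L)ˣ} (h𝓕I : IsIdeleClassDomain L 𝓕I)
    (ν : Measure ↥(adelicUnipotent (↥(maximalRealSubfield L)) L (IsCMField.complexConj L) 2)) [ν.IsHaarMeasure]
    {𝓕 : Set ↥(adelicUnipotent (↥(maximalRealSubfield L)) L (IsCMField.complexConj L) 2)} (h𝓕N : IsFundamentalDomain ↥(rationalUnipotent (↥(maximalRealSubfield L)) L (IsCMField.complexConj L) 2) 𝓕 ν) (h𝓕1 : ν 𝓕 = 1)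
    (h𝓕c : IsCompact (closure 𝓕))
    {T : ℝ≥0} (hT : 1 ≤ T) {φ₀ : ℂ}
    {β : (quasiSplit (↥(maximalRealSubfield L)) L (IsCMField.complexConj L) 2).Adelic → ℝ≥0∞} (hβ : IsCoveringWeight ((arithmeticBorel (↥(maximalRealSubfield L)) L (IsCMField.complexConj L) 2).map (quasiSplit (↥(maximalRealSubfield L)) L (IsCMField.complexConj L) 2).arithmeticSubgroup.subtype) β)
    {c : ℂ → ℂ} (hc : DifferentiableOn ℂ c D₁) (hceq : ∀ z : ℂ, 1 < z.re → c z = (∫ v : ↥(adelicUnipotent (↥(maximalRealSubfield L)) L (IsCMField.complexConj L) 2), (((borelHeight ((quasiSplit (↥(maximalRealSubfield L)) L (IsCMField.complexConj L) 2).toAdelic (weylLongU ((IsCMField.complexConj L : L ≃ₐ[↥(maximalRealSubfield L)] L) : L →+* L) (rfl : (StdForm.antidiagonal 2).over L = (StdForm.antidiagonal 2).over L)) * (v : (quasiSplit (↥(maximalRealSubfield L)) L (IsCMField.complexConj L) 2).Adelic))) : ℝ) : ℂ) ^ z ∂ν))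
    (F : ℂ → Lp ℂ 2 μ) (hFd : DifferentiableOn ℂ F D₁)
    (hFtube : ∀ z ∈ D₁, 1 < z.re → ((F z : Lp ℂ 2 μ) : (quasiSplit (↥(maximalRealSubfield L)) L (IsCMField.complexConj L) 2).automorphicQuotient → ℂ) =ᵐ[μ] (quasiSplit (↥(maximalRealSubfield L)) L (IsCMField.complexConj L) 2).quotFun (truncation ν 𝓕 T (eisensteinSeriesU (flatSectionU (fun _ : (quasiSplit (↥(maximalRealSubfield L)) L (IsCMField.complexConj L) 2).Adelic => φ₀) z))))
 :
    ∃ cμ K : ℝ, 0 < cμ ∧ 0 < K ∧ ∀ z ∈ D₁, (((‖F z‖ ^ 2 : ℝ)) : ℂ) =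
      ((cμ : ℝ) : ℂ) * (((K : ℝ) : ℂ) *
        ((((T : ℝ) : ℂ) ^ (z + conj z - 1) / (z + conj z - 1)) * ((((∫ x in {x : (AdeleRing (𝓞 L) L)ˣ | (IdeleClassGroup.ideleNorm L x : ℝ) ≤ 1} ∩ 𝓕I, (IdeleClassGroup.ideleNorm L x : ℝ) ∂νI) : ℝ) : ℂ) * (((μK.real Set.univ : ℝ) : ℂ) * (φ₀ * conj φ₀)))
          + (((T : ℝ) : ℂ) ^ (z - conj z) / (z - conj z)) * ((((∫ x in {x : (AdeleRing (𝓞 L) L)ˣ | (IdeleClassGroup.ideleNorm L x : ℝ) ≤ 1} ∩ 𝓕I, (IdeleClassGroup.ideleNorm L x : ℝ) ∂νI) : ℝ) : ℂ) * (((μK.real Set.univ : ℝ) : ℂ) * (φ₀ * conj (c z * φ₀))))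
          - (((T : ℝ) : ℂ) ^ (-(z - conj z)) / (z - conj z)) * ((((∫ x in {x : (AdeleRing (𝓞 L) L)ˣ | (IdeleClassGroup.ideleNorm L x : ℝ) ≤ 1} ∩ 𝓕I, (IdeleClassGroup.ideleNorm L x : ℝ) ∂νI) : ℝ) : ℂ) * (((μK.real Set.univ : ℝ) : ℂ) * (c z * φ₀ * conj φ₀)))
          - (((T : ℝ) : ℂ) ^ (-(z + conj z - 1)) / (z + conj z - 1)) * ((((∫ x in {x : (AdeleRing (𝓞 L) L)ˣ | (IdeleClassGroup.ideleNorm L x : ℝ) ≤ 1} ∩ 𝓕I, (IdeleClassGroup.ideleNorm L x : ℝ) ∂νI) : ℝ) : ℂ) * (((μK.real Set.univ : ℝ) : ℂ) * (c z * φ₀ * conj (c z * φ₀)))))) := by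
  obtain ⟨hΦ₁, hΦ₂, hQ⟩ := pairing_of_differentiableOn hD₁ hFd
  have hraw : ∀ z ∈ D₁, ∀ z' ∈ D₁, 1 < z.re → 1 < z'.re →
      ⟪F z', F z⟫_ℂ = ∫ x, (quasiSplit (↥(maximalRealSubfield L)) L (IsCMField.complexConj L) 2).quotFun (truncation ν 𝓕 T (eisensteinSeriesU (flatSectionU (fun _ : (quasiSplit (↥(maximalRealSubfield L)) L (IsCMField.complexConj L) 2).Adelic => φ₀) z))) x * conj ((quasiSplit (↥(maximalRealSubfield L)) L (IsCMField.complexConj L) 2).quotFun (truncation ν 𝓕 T (eisensteinSeriesU (flatSectionU (fun _ : (quasiSplit (↥(maximalRealSubfield L)) L (IsCMField.complexConj L) 2).Adelic => φ₀) z'))) x) ∂μ := by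
    intro z hz z' hz' hz1 hz'1
    rw [MeasureTheory.L2.inner_def]
    refine integral_congr_ae ?_
    filter_upwards [hFtube z hz hz1, hFtube z' hz' hz'1] with x hx hx'
    rw [hx, hx', RCLike.inner_apply, mul_comm]
  obtain ⟨cμ, K, hcμ, hK, h4⟩ := exists_fourTerm_tube_cm_two L μ νG μK νI h𝓕I ν h𝓕N h𝓕1 h𝓕c T hT φ₀ hβ c hceq
  have hrel : ∀ z ∈ D₁, ∀ z' ∈ D₁, 1 < z'.re → z'.re < z.re →
      ⟪F z', F z⟫_ℂ = ((cμ : ℝ) : ℂ) * (((K : ℝ) : ℂ) *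
        ((((T : ℝ) : ℂ) ^ (z + conj z' - 1) / (z + conj z' - 1)) * ((((∫ x in {x : (AdeleRing (𝓞 L) L)ˣ | (IdeleClassGroup.ideleNorm L x : ℝ) ≤ 1} ∩ 𝓕I, (IdeleClassGroup.ideleNorm L x : ℝ) ∂νI) : ℝ) : ℂ) * (((μK.real Set.univ : ℝ) : ℂ) * (φ₀ * conj φ₀)))
          + (((T : ℝ) : ℂ) ^ (z - conj z') / (z - conj z')) * ((((∫ x in {x : (AdeleRing (𝓞 L) L)ˣ | (IdeleClassGroup.ideleNorm L x : ℝ) ≤ 1} ∩ 𝓕I, (IdeleClassGroup.ideleNorm L x : ℝ) ∂νI) : ℝ) : ℂ) * (((μK.real Set.univ : ℝ) : ℂ) * (φ₀ * conj (c z' * φ₀))))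
          - (((T : ℝ) : ℂ) ^ (-(z - conj z')) / (z - conj z')) * ((((∫ x in {x : (AdeleRing (𝓞 L) L)ˣ | (IdeleClassGroup.ideleNorm L x : ℝ) ≤ 1} ∩ 𝓕I, (IdeleClassGroup.ideleNorm L x : ℝ) ∂νI) : ℝ) : ℂ) * (((μK.real Set.univ : ℝ) : ℂ) * (c z * φ₀ * conj φ₀)))
          - (((T : ℝ) : ℂ) ^ (-(z + conj z' - 1)) / (z + conj z' - 1)) * ((((∫ x in {x : (AdeleRing (𝓞 L) L)ˣ | (IdeleClassGroup.ideleNorm L x : ℝ) ≤ 1} ∩ 𝓕I, (IdeleClassGroup.ideleNorm L x : ℝ) ∂νI) : ℝ) : ℂ) * (((μK.real Set.univ : ℝ) : ℂ) * (c z * φ₀ * conj (c z' * φ₀)))))) := by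
    intro z hz z' hz' h1 h2
    rw [hraw z hz z' hz' (h1.trans h2) h1]
    exact h4 z z' h1 h2
  refine ⟨cμ, K, hcμ, hK, fun z hz => ?_⟩
  rw [← (hQ z hz).2]
  exact diag_eq_fourTerm_of_pairing_on' hD₁ hD₁c hD₁sub hO₁ hO₁ne hO₁D hO₂' hO₂'ne hO₂'D hsep (T := (T : ℝ)) (by exact_mod_cast hT) hc
    (Φ := fun z z' => ⟪F z', F z⟫_ℂ) hΦ₁ hΦ₂ hrel hz

/-! ## §2 The `L²`-norm of the family is locally bounded off the real axis wherever the scalar is -/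

/-- **`‖F z‖` IS BOUNDED NEAR A NON-REAL POINT `z₀` (`1 < Re z₀`, `0 < Im z₀`) ON `D₁` AS SOON AS `c̃` IS**: under the hypotheses of ★ `poleControl_continued_cm_two_of_family_on'`,
if `‖c̃ z‖ ≤ C₁` for `z ∈ D₁` near `z₀` (punctured neighbourhood), then `‖F z‖ ≤ C` for `z ∈ D₁` near `z₀`.  Proof: §1 `‖F z‖² = R(z, z; c̃)`; the map `(z, u) ↦ R(z, z; u)`
(the scalar `c̃ z` replaced by a free variable `u`) is continuous on `D⁺ × ℂ` (denominators `2Re z − 1 ≠ 0`, `2i·Im z ≠ 0`), hence bounded on the compact `closedBall z₀ r × closedBall 0 C₁`.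
No bound is asserted near REAL points (where `Im z → 0`). [cite: MoeglinWaldspurger1995, IV.2.3, IV.3.12 (a)] [cite: BernsteinLapid2019, §4] -/
theorem norm_family_le_of_scalar_bound_on' {D₁ : Set ℂ} (hD₁ : IsOpen D₁) (hD₁c : IsPreconnected D₁) (hD₁sub : D₁ ⊆ {z : ℂ | 1 / 2 < z.re ∧ 0 < z.im})
    {O₁ O₂' : Set ℂ} (hO₁ : IsOpen O₁) (hO₁ne : O₁.Nonempty) (hO₁D : O₁ ⊆ D₁) (hO₂' : IsOpen O₂') (hO₂'ne : O₂'.Nonempty) (hO₂'D : O₂' ⊆ D₁)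
    (hsep : ∀ z ∈ O₁, ∀ z' ∈ O₂', 1 < z'.re ∧ z'.re < z.re)
    (μ : Measure (quasiSplit (↥(maximalRealSubfield L)) L (IsCMField.complexConj L) 2).automorphicQuotient) [(quasiSplit (↥(maximalRealSubfield L)) L (IsCMField.complexConj L) 2).IsAutomorphicMeasure μ]
    (νG : Measure (quasiSplit (↥(maximalRealSubfield L)) L (IsCMField.complexConj L) 2).Adelic) [νG.IsHaarMeasure] [νG.IsInvInvariant]
    (μK : Measure ((standardMaximalCompactGL 2 L).comap (adelicVal (↥(maximalRealSubfield L)) L (IsCMField.complexConj L) 2 ((StdForm.antidiagonal 2).over L)) : Subgroup (quasiSplit (↥(maximalRealSubfield L)) L (IsCMField.complexConj L) 2).Adelic))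
    [μK.IsHaarMeasure]
    (νI : Measure (AdeleRing (𝓞 L) L)ˣ) [νI.IsHaarMeasure]
    {𝓕I : Set (AdeleRing (𝓞 L) L)ˣ} (h𝓕I : IsIdeleClassDomain L 𝓕I)
    (ν : Measure ↥(adelicUnipotent (↥(maximalRealSubfield L)) L (IsCMField.complexConj L) 2)) [ν.IsHaarMeasure]
    {𝓕 : Set ↥(adelicUnipotent (↥(maximalRealSubfield L)) L (IsCMField.complexConj L) 2)} (h𝓕N : IsFundamentalDomain ↥(rationalUnipotent (↥(maximalRealSubfield L)) L (IsCMField.complexConj L) 2) 𝓕 ν) (h𝓕1 : ν 𝓕 = 1)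
    (h𝓕c : IsCompact (closure 𝓕))
    {T : ℝ≥0} (hT : 1 ≤ T) {φ₀ : ℂ}
    {β : (quasiSplit (↥(maximalRealSubfield L)) L (IsCMField.complexConj L) 2).Adelic → ℝ≥0∞} (hβ : IsCoveringWeight ((arithmeticBorel (↥(maximalRealSubfield L)) L (IsCMField.complexConj L) 2).map (quasiSplit (↥(maximalRealSubfield L)) L (IsCMField.complexConj L) 2).arithmeticSubgroup.subtype) β)
    {c : ℂ → ℂ} (hc : DifferentiableOn ℂ c D₁) (hceq : ∀ z : ℂ, 1 < z.re → c z = (∫ v : ↥(adelicUnipotent (↥(maximalRealSubfield L)) L (IsCMField.complexConj L) 2), (((borelHeight ((quasiSplit (↥(maximalRealSubfield L)) L (IsCMField.complexConj L) 2).toAdelic (weylLongU ((IsCMField.complexConj L : L ≃ₐ[↥(maximalRealSubfield L)] L) : L →+* L) (rfl : (StdForm.antidiagonal 2).over L = (StdForm.antidiagonal 2).over L)) * (v : (quasiSplit (↥(maximalRealSubfield L)) L (IsCMField.complexConj L) 2).Adelic))) : ℝ) : ℂ) ^ z ∂ν))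
    (F : ℂ → Lp ℂ 2 μ) (hFd : DifferentiableOn ℂ F D₁)
    (hFtube : ∀ z ∈ D₁, 1 < z.re → ((F z : Lp ℂ 2 μ) : (quasiSplit (↥(maximalRealSubfield L)) L (IsCMField.complexConj L) 2).automorphicQuotient → ℂ) =ᵐ[μ] (quasiSplit (↥(maximalRealSubfield L)) L (IsCMField.complexConj L) 2).quotFun (truncation ν 𝓕 T (eisensteinSeriesU (flatSectionU (fun _ : (quasiSplit (↥(maximalRealSubfield L)) L (IsCMField.complexConj L) 2).Adelic => φ₀) z))))
    {z₀ : ℂ} (hz₀ : 1 / 2 < z₀.re ∧ 0 < z₀.im) {C₁ : ℝ} (hcb : ∀ᶠ z in 𝓝[≠] z₀, z ∈ D₁ → ‖c z‖ ≤ C₁) :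
    ∃ C : ℝ, ∀ᶠ z in 𝓝[≠] z₀, z ∈ D₁ → ‖F z‖ ≤ C := by
  obtain ⟨cμ, K, -, -, hdiag⟩ := normSq_family_eq_fourTerm_on' L hD₁ hD₁c hD₁sub hO₁ hO₁ne hO₁D hO₂' hO₂'ne hO₂'D hsep μ νG μK νI h𝓕I ν h𝓕N h𝓕1 h𝓕c hT hβ hc hceq F hFd hFtube
  -- the two-variable four-term map `(z, u) ↦ R(z, z; u)`
  set S : Set ℂ := {z : ℂ | 1 / 2 < z.re ∧ 0 < z.im} with hSdef
  have hSo : IsOpen S := (isOpen_lt continuous_const Complex.continuous_re).inter (isOpen_lt continuous_const Complex.continuous_im)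
  have hT0 : (((T : ℝ) : ℂ)) ≠ 0 := Complex.ofReal_ne_zero.2 (lt_of_lt_of_le one_pos (show (1 : ℝ) ≤ T by exact_mod_cast hT)).ne'
  have hne : ∀ p ∈ S ×ˢ (Set.univ : Set ℂ), p.1 + conj p.1 - 1 ≠ 0 ∧ p.1 - conj p.1 ≠ 0 := by
    rintro ⟨z, u⟩ ⟨hz, -⟩
    have hw : conj z ∈ {w : ℂ | 1 / 2 < w.re ∧ w.im < 0} := ⟨by rw [Complex.conj_re]; exact hz.1, by rw [Complex.conj_im]; linarith [hz.2]⟩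
    exact add_sub_one_ne_zero_and_sub_ne_zero hz hw
  set G : ℂ × ℂ → ℂ := fun p =>
      ((cμ : ℝ) : ℂ) * (((K : ℝ) : ℂ) *
        ((((T : ℝ) : ℂ) ^ (p.1 + conj p.1 - 1) / (p.1 + conj p.1 - 1)) * ((((∫ x in {x : (AdeleRing (𝓞 L) L)ˣ | (IdeleClassGroup.ideleNorm L x : ℝ) ≤ 1} ∩ 𝓕I, (IdeleClassGroup.ideleNorm L x : ℝ) ∂νI) : ℝ) : ℂ) * (((μK.real Set.univ : ℝ) : ℂ) * (φ₀ * conj φ₀)))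
          + (((T : ℝ) : ℂ) ^ (p.1 - conj p.1) / (p.1 - conj p.1)) * ((((∫ x in {x : (AdeleRing (𝓞 L) L)ˣ | (IdeleClassGroup.ideleNorm L x : ℝ) ≤ 1} ∩ 𝓕I, (IdeleClassGroup.ideleNorm L x : ℝ) ∂νI) : ℝ) : ℂ) * (((μK.real Set.univ : ℝ) : ℂ) * (φ₀ * conj (p.2 * φ₀))))
          - (((T : ℝ) : ℂ) ^ (-(p.1 - conj p.1)) / (p.1 - conj p.1)) * ((((∫ x in {x : (AdeleRing (𝓞 L) L)ˣ | (IdeleClassGroup.ideleNorm L x : ℝ) ≤ 1} ∩ 𝓕I, (IdeleClassGroup.ideleNorm L x : ℝ) ∂νI) : ℝ) : ℂ) * (((μK.real Set.univ : ℝ) : ℂ) * (p.2 * φ₀ * conj φ₀)))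
          - (((T : ℝ) : ℂ) ^ (-(p.1 + conj p.1 - 1)) / (p.1 + conj p.1 - 1)) * ((((∫ x in {x : (AdeleRing (𝓞 L) L)ˣ | (IdeleClassGroup.ideleNorm L x : ℝ) ≤ 1} ∩ 𝓕I, (IdeleClassGroup.ideleNorm L x : ℝ) ∂νI) : ℝ) : ℂ) * (((μK.real Set.univ : ℝ) : ℂ) * (p.2 * φ₀ * conj (p.2 * φ₀)))))) with hGdef
  have hz1 : ContinuousOn (fun p : ℂ × ℂ => p.1 + conj p.1 - 1) (S ×ˢ (Set.univ : Set ℂ)) :=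
    ((continuous_fst.add (Complex.continuous_conj.comp continuous_fst)).sub continuous_const).continuousOn
  have hz2 : ContinuousOn (fun p : ℂ × ℂ => p.1 - conj p.1) (S ×ˢ (Set.univ : Set ℂ)) :=
    (continuous_fst.sub (Complex.continuous_conj.comp continuous_fst)).continuousOn
  have hu : Continuous (fun p : ℂ × ℂ => p.2) := continuous_snd
  have e₁ : ContinuousOn (fun p : ℂ × ℂ => ((T : ℝ) : ℂ) ^ (p.1 + conj p.1 - 1) / (p.1 + conj p.1 - 1)) (S ×ˢ (Set.univ : Set ℂ)) :=
    (hz1.const_cpow (Or.inl hT0)).div hz1 fun p hp => (hne p hp).1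
  have e₂ : ContinuousOn (fun p : ℂ × ℂ => ((T : ℝ) : ℂ) ^ (p.1 - conj p.1) / (p.1 - conj p.1)) (S ×ˢ (Set.univ : Set ℂ)) :=
    (hz2.const_cpow (Or.inl hT0)).div hz2 fun p hp => (hne p hp).2
  have e₃ : ContinuousOn (fun p : ℂ × ℂ => ((T : ℝ) : ℂ) ^ (-(p.1 - conj p.1)) / (p.1 - conj p.1)) (S ×ˢ (Set.univ : Set ℂ)) :=
    (hz2.neg.const_cpow (Or.inl hT0)).div hz2 fun p hp => (hne p hp).2
  have e₄ : ContinuousOn (fun p : ℂ × ℂ => ((T : ℝ) : ℂ) ^ (-(p.1 + conj p.1 - 1)) / (p.1 + conj p.1 - 1)) (S ×ˢ (Set.univ : Set ℂ)) :=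
    (hz1.neg.const_cpow (Or.inl hT0)).div hz1 fun p hp => (hne p hp).1
  have b₂ : Continuous (fun p : ℂ × ℂ => (((∫ x in {x : (AdeleRing (𝓞 L) L)ˣ | (IdeleClassGroup.ideleNorm L x : ℝ) ≤ 1} ∩ 𝓕I, (IdeleClassGroup.ideleNorm L x : ℝ) ∂νI) : ℝ) : ℂ) * (((μK.real Set.univ : ℝ) : ℂ) * (φ₀ * conj (p.2 * φ₀)))) :=
    continuous_const.mul (continuous_const.mul (continuous_const.mul (Complex.continuous_conj.comp (hu.mul continuous_const))))
  have b₃ : Continuous (fun p : ℂ × ℂ => (((∫ x in {x : (AdeleRing (𝓞 L) L)ˣ | (IdeleClassGroup.ideleNorm L x : ℝ) ≤ 1} ∩ 𝓕I, (IdeleClassGroup.ideleNorm L x : ℝ) ∂νI) : ℝ) : ℂ) * (((μK.real Set.univ : ℝ) : ℂ) * (p.2 * φ₀ * conj φ₀))) :=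
    continuous_const.mul (continuous_const.mul ((hu.mul continuous_const).mul continuous_const))
  have b₄ : Continuous (fun p : ℂ × ℂ => (((∫ x in {x : (AdeleRing (𝓞 L) L)ˣ | (IdeleClassGroup.ideleNorm L x : ℝ) ≤ 1} ∩ 𝓕I, (IdeleClassGroup.ideleNorm L x : ℝ) ∂νI) : ℝ) : ℂ) * (((μK.real Set.univ : ℝ) : ℂ) * (p.2 * φ₀ * conj (p.2 * φ₀)))) :=
    continuous_const.mul (continuous_const.mul ((hu.mul continuous_const).mul (Complex.continuous_conj.comp (hu.mul continuous_const))))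
  have hGc : ContinuousOn G (S ×ˢ (Set.univ : Set ℂ)) :=
    continuousOn_const.mul (continuousOn_const.mul ((((e₁.mul continuousOn_const).add (e₂.mul b₂.continuousOn)).sub (e₃.mul b₃.continuousOn)).sub (e₄.mul b₄.continuousOn)))
  -- a compact neighbourhood on which `G` is bounded
  obtain ⟨r, hr0, hrS⟩ := Metric.nhds_basis_closedBall.mem_iff.1 (hSo.mem_nhds hz₀)
  obtain ⟨M, hM⟩ := ((isCompact_closedBall z₀ r).prod (isCompact_closedBall (0 : ℂ) C₁)).exists_bound_of_continuousOn
    (hGc.mono (Set.prod_mono hrS (Set.subset_univ _)))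
  refine ⟨Real.sqrt M, ?_⟩
  have hball : ∀ᶠ z in 𝓝[≠] z₀, z ∈ Metric.closedBall z₀ r := mem_nhdsWithin_of_mem_nhds (Metric.closedBall_mem_nhds z₀ hr0)
  filter_upwards [hcb, hball] with z hcz hzr hzD
  have hmem : (z, c z) ∈ Metric.closedBall z₀ r ×ˢ Metric.closedBall (0 : ℂ) C₁ := ⟨hzr, by rw [Metric.mem_closedBall, dist_zero_right]; exact hcz hzD⟩
  have hsq : ‖F z‖ ^ 2 ≤ M := by
    have h1 := hM (z, c z) hmem
    rw [show G (z, c z) = (((‖F z‖ ^ 2 : ℝ)) : ℂ) from (hdiag z hzD).symm, Complex.norm_real, Real.norm_of_nonneg (sq_nonneg _)] at h1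
    exact h1
  calc ‖F z‖ = Real.sqrt (‖F z‖ ^ 2) := (Real.sqrt_sq (norm_nonneg _)).symm
    _ ≤ Real.sqrt M := Real.sqrt_le_sqrt hsq

end Family

end Summit.HodgeConjecture.HodgeConjecture.Cruxes.H413.K2E1MaassSelbergDiagonalFourTermCMTwo

end
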